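import Summits.QuantumFields.BalabanUV.Beta.AxialDressingRootedBridge
import Summits.QuantumFields.BalabanUV.Beta.TameKernelCalculus
import Literature.MathematicalPhysics.QuantumFieldTheory.Balaban1983to89.Beta.BalabanStepJetsSucc

/-!
# The ROOTED axial dressing `Πᵀ_ρ` — part 4: the dressing as KERNEL COMPOSITION, the co-dressed resolvent
# `G = Π_ρ K Πᵀ_ρ`, and the dressed-kernel identity `TstepOf Lc j (dressAt hr J) = hessKer G (vertexOfK G Lc J.S) J.W`

HONEST FRAMING (cell charter, verbatim): «discharging BetaPertH makes Balaban's UV stability UNCONDITIONAL — a real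
constructive-QFT result; it is NOT the continuum limit and NOT the Clay problem.»  DERIVED cell leaf (pub-balaban β sub-cell,
lane an2 gen 12, item (ii-0) of NOTE X-an2-41 §4); no statement of Bałaban's papers is typed here, no `[cite:]` tag, no `Prop`
fact; it instantiates no binder of the β-function wall by itself.  NOT `BetaPertH`; NOT continuum; NOT Clay.

## What is here

Parts 1–3 (`AxialDressingRooted`, `…Legs`, `…Bridge`) define the rooted dressing by FINITE WINDOW SUMS: `coProjAt ρ N`
(the transpose matrix `pm ρ N` of an5's rooted comb projector `RootedComb.axProjAt ρ N`, read on the offset window `cube`),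
the leg dressings `legCo₁At` / `legCo₂At` / `dressKAt`, the bond slot `coProjAtK` and the functor `dressAt hr` on `JetData`.
This part re-expresses them in the `ExpKernelCalculus` currency (`comp`, `tr`) so that an5's tame trace calculus applies:

* §1 `piK ρ N : MKer (d+1) (Fib d)` — THE PROJECTOR KERNEL: field block `((α,x),(β,x′)) ↦ [x′ − x ∈ cube]·pm ρ N β x′ α x`
  (the matrix `Πᵀ_ρ`), multiplier block the identity, mixed blocks `0`; entry rules; `decays_piK` (finite range ⇒ decays at
  EVERY rate, in-block root), `spr_piK`, block-translation covariance `shiftK_piK`.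
* §2 `legCo₁At ρ N K = comp (piK ρ N) K`, `legCo₂At ρ N K = comp K (trK (piK ρ N))`, hence
  `dressKAt ρ N K = comp (comp (piK ρ N) K) (trK (piK ρ N))` (`Πᵀ K Π` in the letters of X-an2-41).
* §3 `coDressKAt ρ N K := comp (comp (trK (piK ρ N)) K) (piK ρ N)` — THE CO-DRESSED KERNEL `Π K Πᵀ` (the kernel that meets the
  UNDRESSED jets); `decays_coDressKAt`, `shiftK_coDressKAt`, and the `ℋ`-column rule `colH_coDressKAt` (right composition with
  `piK` does not touch multiplier columns).
* §4 the vertex transfer `vertexOfK K N (dressed stencils) μ y = dressKAt ρ N (vertexOfK (coDressKAt ρ N K) N S μ y)`.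
* §5 **`hessKer_dressAt`**: for every decaying `K` and every jet datum `J`,
  `hessKer K (vertexOfK K N (dressAt hr J).S) (dressAt hr J).W = hessKer G (vertexOfK G N J.S) J.W`, `G := coDressKAt (toSite r) N K`
  (tame trace cyclicity + associativity, an5's `TameKernelCalculus` BY NAME); **`TstepOf_dressAt`**, **`TbalOf_dressAt`** (d = 3).

WHY (X-an2-41 §4 (ii-0)).  The wall literal's family is dressed (`SpineRooted.JsBalAn1At … = dressAt hr ∘ …`); this file puts
its one-step kernels LITERALLY in the shape `hessKer K′ (vertexOfK K′ N J.S) J.W` of an5's `ChartConjugationEnd` ENDs, with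
`K′ := G` the co-dressed step resolvent and `J` the UNDRESSED jets — so the reflection-covariance END is to be fed with `G`
(a RELATIVE inverse of the undressed bordered Hessian, X-an2-41 §1) and the undressed jet laws.  Nothing here asserts any
inverse identity for `G`; (ii-1) is a separate item.

All declarations `[folklore]` (finite sums, absolutely convergent lattice sums); axioms standard.
Provenance: b2b-balaban β sub-cell, unit beta-an2 gen 12, 2026-08-19 (v1); over parts 1–3 (an2 gen 11), an5's
`TameKernelCalculus` (gen 18) and `BalabanStepJetsSucc.decays_comp` BY NAME; no existing file touched.
-/

open Finset
open scoped BigOperators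
open Literature.MathematicalPhysics.QuantumFieldTheory
open Literature.MathematicalPhysics.QuantumFieldTheory.Balaban1983to89
open Literature.MathematicalPhysics.QuantumFieldTheory.Balaban1983to89.Beta
open B12Sec2to5 (l1 l1_nonneg)
open ExpKernelCalculus (MKer Decays BiLoc comp tr bubble tadpole hessKer VertexFamily VertexFamily₂ shiftK l1_sub_symm)
open AffineAveraging (Form0 Form1 box toSite)
open AveragingContoursRooted (ctrOff ctrOff_mem_box)
open OneStepResolventKernel (Fib wsum LocStencil JetData)
open OneStepKernelFamily (KInvStep decays_KInvStep shiftK_KInvStep colH vertexOfK vertexFamily_vertexOfK' TstepOf TbalOf)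
open Summit.QuantumFields.BalabanUV.Beta.TameKernelCalculus

namespace Summit.QuantumFields.BalabanUV.Beta.AxialDressingRooted

noncomputable section

variable {d : ℕ}

/-! ## §1 The projector kernel `piK ρ N` (the matrix `Πᵀ_ρ` on the field block, the identity on the multiplier block) -/

section PiK

/-- [folklore] **THE PROJECTOR KERNEL** `piK ρ N`: on the field block the windowed transpose matrix
`((α,x),(β,x′)) ↦ [x′ − x ∈ cube]·pm ρ N β x′ α x` of the rooted comb projector, on the multiplier block the identity,
mixed blocks zero. -/
def piK (ρ : Fin (d + 1) → ℤ) (N : ℕ) : MKer (d + 1) (Fib d) :=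
  fun x x' a b =>
    match a, b with
    | Sum.inl α, Sum.inl β => if x' - x ∈ cube (d + 1) N then (pm ρ N β x' α x : ℝ) else 0
    | Sum.inl _, Sum.inr _ => 0
    | Sum.inr _, Sum.inl _ => 0
    | Sum.inr m, Sum.inr m' => if x = x' ∧ m = m' then 1 else 0

variable (ρ : Fin (d + 1) → ℤ) (N : ℕ)

/-- [folklore] Field–field entry of `piK`. -/
theorem piK_inl_inl (x x' : Fin (d + 1) → ℤ) (α β : Fin (d + 1)) :
    piK ρ N x x' (Sum.inl α) (Sum.inl β) = if x' - x ∈ cube (d + 1) N then (pm ρ N β x' α x : ℝ) else 0 := rfl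

/-- [folklore] Field–multiplier entry of `piK` vanishes. -/
theorem piK_inl_inr (x x' : Fin (d + 1) → ℤ) (α m : Fin (d + 1)) : piK ρ N x x' (Sum.inl α) (Sum.inr m) = 0 := rfl

/-- [folklore] Multiplier–field entry of `piK` vanishes. -/
theorem piK_inr_inl (x x' : Fin (d + 1) → ℤ) (m α : Fin (d + 1)) : piK ρ N x x' (Sum.inr m) (Sum.inl α) = 0 := rfl

/-- [folklore] Multiplier–multiplier entry of `piK` is the identity. -/
theorem piK_inr_inr (x x' : Fin (d + 1) → ℤ) (m m' : Fin (d + 1)) :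
    piK ρ N x x' (Sum.inr m) (Sum.inr m') = if x = x' ∧ m = m' then 1 else 0 := rfl

/-- [folklore] Fibre contraction against a ROW of `piK`, field row: a windowed `pm`-sum over the field components. -/
theorem sum_piK_mul_inl (x x' : Fin (d + 1) → ℤ) (α : Fin (d + 1)) (g : Fib d → ℝ) :
    ∑ f : Fib d, piK ρ N x x' (Sum.inl α) f * g f =
      if x' - x ∈ cube (d + 1) N then ∑ β : Fin (d + 1), (pm ρ N β x' α x : ℝ) * g (Sum.inl β) else 0 := by
  rw [Fintype.sum_sum_type]
  simp only [piK_inl_inl, piK_inl_inr, zero_mul, Finset.sum_const_zero, add_zero]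
  split_ifs
  · rfl
  · simp

/-- [folklore] Fibre contraction against a ROW of `piK`, multiplier row: the Kronecker delta. -/
theorem sum_piK_mul_inr (x x' : Fin (d + 1) → ℤ) (m : Fin (d + 1)) (g : Fib d → ℝ) :
    ∑ f : Fib d, piK ρ N x x' (Sum.inr m) f * g f = if x = x' then g (Sum.inr m) else 0 := by
  rw [Fintype.sum_sum_type]
  simp only [piK_inr_inl, piK_inr_inr, zero_mul, Finset.sum_const_zero, zero_add]
  by_cases h : x = x'
  · simp only [h, true_and, ite_mul, one_mul, zero_mul, Finset.sum_ite_eq, Finset.mem_univ, if_true]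
  · simp [h]

/-- [folklore] Fibre contraction against a COLUMN of `piK` (i.e. a row of `trK piK`), field column. -/
theorem sum_mul_piK_inl (y y' : Fin (d + 1) → ℤ) (β : Fin (d + 1)) (g : Fib d → ℝ) :
    ∑ f : Fib d, g f * piK ρ N y y' (Sum.inl β) f =
      if y' - y ∈ cube (d + 1) N then ∑ β' : Fin (d + 1), (pm ρ N β' y' β y : ℝ) * g (Sum.inl β') else 0 := by
  rw [Fintype.sum_sum_type]
  simp only [piK_inl_inl, piK_inl_inr, mul_zero, Finset.sum_const_zero, add_zero]
  split_ifs
  · exact Finset.sum_congr rfl fun β' _ => mul_comm _ _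
  · simp

/-- [folklore] Fibre contraction against a COLUMN of `piK`, multiplier column. -/
theorem sum_mul_piK_inr (y y' : Fin (d + 1) → ℤ) (m : Fin (d + 1)) (g : Fib d → ℝ) :
    ∑ f : Fib d, g f * piK ρ N y y' (Sum.inr m) f = if y = y' then g (Sum.inr m) else 0 := by
  rw [Fintype.sum_sum_type]
  simp only [piK_inr_inl, piK_inr_inr, mul_zero, Finset.sum_const_zero, zero_add]
  by_cases h : y = y'
  · simp only [h, true_and, mul_ite, mul_one, mul_zero, Finset.sum_ite_eq, Finset.mem_univ, if_true]
  · simp [h]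

/-- [folklore] Fibre contraction against a COLUMN of `piK` with field column index: a windowed `pm`-sum. -/
theorem sum_piK_col_inl (u u' : Fin (d + 1) → ℤ) (κ' : Fin (d + 1)) (g : Fib d → ℝ) :
    ∑ f : Fib d, piK ρ N u u' f (Sum.inl κ') * g f =
      if u' - u ∈ cube (d + 1) N then ∑ κ : Fin (d + 1), (pm ρ N κ' u' κ u : ℝ) * g (Sum.inl κ) else 0 := by
  rw [Fintype.sum_sum_type]
  simp only [piK_inl_inl, piK_inr_inl, zero_mul, Finset.sum_const_zero, add_zero]
  split_ifs
  · rfl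
  · simp

/-- [folklore] A lattice sum of a function supported on the window `x + cube` is the finite window sum. -/
theorem tsum_window (x : Fin (d + 1) → ℤ) (h : (Fin (d + 1) → ℤ) → ℝ) :
    ∑' x', (if x' - x ∈ cube (d + 1) N then h x' else 0) = ∑ v ∈ cube (d + 1) N, h (x + v) := by
  classical
  have hinj : Set.InjOn (fun v : Fin (d + 1) → ℤ => x + v) ↑(cube (d + 1) N) := fun v _ w _ hvw => add_left_cancel hvw
  rw [tsum_eq_sum (s := (cube (d + 1) N).image fun v => x + v)]
  · rw [Finset.sum_image hinj]
    refine Finset.sum_congr rfl fun v hv => ?_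
    rw [if_pos (by simpa using hv)]
  · intro x' hx'
    rw [if_neg]
    intro hmem
    exact hx' (Finset.mem_image.2 ⟨x' - x, hmem, by abel⟩)

/-- [folklore] A lattice sum of a function supported at one point. -/
theorem tsum_point (x : Fin (d + 1) → ℤ) (h : (Fin (d + 1) → ℤ) → ℝ) :
    ∑' x', (if x = x' then h x' else 0) = h x := by
  rw [tsum_eq_single x fun x' hx' => if_neg (Ne.symm hx')]
  rw [if_pos rfl]

/-- [folklore] A lattice sum of a function supported on the reflected window `x − cube`. -/
theorem tsum_window' (x : Fin (d + 1) → ℤ) (h : (Fin (d + 1) → ℤ) → ℝ) :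
    ∑' x', (if x - x' ∈ cube (d + 1) N then h x' else 0) = ∑ v ∈ cube (d + 1) N, h (x - v) := by
  classical
  have hinj : Set.InjOn (fun v : Fin (d + 1) → ℤ => x - v) ↑(cube (d + 1) N) := fun v _ w _ hvw => sub_right_injective hvw
  rw [tsum_eq_sum (s := (cube (d + 1) N).image fun v => x - v)]
  · rw [Finset.sum_image hinj]
    refine Finset.sum_congr rfl fun v hv => ?_
    rw [if_pos (by simpa using hv)]
  · intro x' hx'
    rw [if_neg]
    intro hmem
    exact hx' (Finset.mem_image.2 ⟨x - x', hmem, by abel⟩)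

/-- [folklore] A lattice sum of a function supported at one point (primed form). -/
theorem tsum_point' (x : Fin (d + 1) → ℤ) (h : (Fin (d + 1) → ℤ) → ℝ) :
    ∑' x', (if x' = x then h x' else 0) = h x := by
  rw [tsum_eq_single x fun x' hx' => if_neg hx']
  rw [if_pos rfl]

end PiK

/-! ## §1b `piK` decays at every rate (in-block root) and is block-translation invariant -/

section PiKBounds

/-- [folklore] The decay constant of the projector kernel at rate `δ`: `cP d N δ := (1 + 2(d+1)N)·exp(δ(d+1)N)`. -/
def cP (d N : ℕ) (δ : ℝ) : ℝ := (1 + 2 * (((d : ℝ) + 1) * N)) * Real.exp (δ * (((d : ℝ) + 1) * N))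

/-- [folklore] `1 ≤ cP` for `δ ≥ 0`. -/
theorem one_le_cP (d N : ℕ) {δ : ℝ} (hδ : 0 ≤ δ) : 1 ≤ cP d N δ := by
  unfold cP
  have h1 : (1 : ℝ) ≤ 1 + 2 * (((d : ℝ) + 1) * N) := by
    have : (0 : ℝ) ≤ ((d : ℝ) + 1) * N := by positivity
    linarith
  have h2 : (1 : ℝ) ≤ Real.exp (δ * (((d : ℝ) + 1) * N)) := Real.one_le_exp (by positivity)
  nlinarith

/-- [folklore] `0 ≤ cP`. -/
theorem cP_nonneg (d N : ℕ) (δ : ℝ) : 0 ≤ cP d N δ := by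
  unfold cP
  have : (0 : ℝ) ≤ ((d : ℝ) + 1) * N := by positivity
  exact mul_nonneg (by linarith) (Real.exp_pos _).le

/-- [folklore] **THE PROJECTOR KERNEL DECAYS AT EVERY RATE** (finite range `≤ (d+1)N`, entries `≤ 1 + 2(d+1)N` for an in-block
root): `Decays (piK (toSite r) N) (cP d N δ) δ` for all `δ ≥ 0`. -/
theorem decays_piK {N : ℕ} (hN : 1 ≤ N) {r : Fin (d + 1) → ℕ} (hr : r ∈ box (d + 1) N) {δ : ℝ} (hδ : 0 ≤ δ) :
    Decays (piK (toSite r) N) (cP d N δ) δ := by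
  intro x x' a b
  have hpos : 0 ≤ cP d N δ * Real.exp (-δ * l1 (x - x')) := mul_nonneg (cP_nonneg d N δ) (Real.exp_pos _).le
  rcases a with α | m <;> rcases b with β | m'
  · rw [piK_inl_inl]
    split_ifs with h
    · have hl : l1 (x - x') ≤ ((d : ℝ) + 1) * N := by
        rw [l1_sub_symm]
        have := l1_le_of_mem_cube h
        push_cast at this
        exact this
      have hpm : |(pm (toSite r) N β x' α x : ℝ)| ≤ 1 + 2 * (((d : ℝ) + 1) * N) := by
        have := abs_pm_le_real hN hr β x' α x
        push_cast at this
        exact this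
      have hA : (0 : ℝ) ≤ 1 + 2 * (((d : ℝ) + 1) * N) := by
        have : (0 : ℝ) ≤ ((d : ℝ) + 1) * N := by positivity
        linarith
      have he : (1 : ℝ) ≤ Real.exp (δ * (((d : ℝ) + 1) * N)) * Real.exp (-δ * l1 (x - x')) := by
        rw [← Real.exp_add]
        exact Real.one_le_exp (by nlinarith)
      calc |(pm (toSite r) N β x' α x : ℝ)| ≤ (1 + 2 * (((d : ℝ) + 1) * N)) * 1 := by rw [mul_one]; exact hpm
        _ ≤ (1 + 2 * (((d : ℝ) + 1) * N)) * (Real.exp (δ * (((d : ℝ) + 1) * N)) * Real.exp (-δ * l1 (x - x'))) :=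
            mul_le_mul_of_nonneg_left he hA
        _ = cP d N δ * Real.exp (-δ * l1 (x - x')) := by unfold cP; ring
    · rw [abs_zero]; exact hpos
  · rw [piK_inl_inr, abs_zero]; exact hpos
  · rw [piK_inr_inl, abs_zero]; exact hpos
  · rw [piK_inr_inr]
    split_ifs with h
    · rw [h.1, sub_self, abs_one]
      have h0 : l1 (0 : Fin (d + 1) → ℤ) = 0 := by simp [l1]
      rw [h0, mul_zero, Real.exp_zero, mul_one]
      exact one_le_cP d N hδ
    · rw [abs_zero]; exact hpos

/-- [folklore] The projector kernel is SPREAD (an5's class `Spr`). -/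
theorem spr_piK {N : ℕ} (hN : 1 ≤ N) {r : Fin (d + 1) → ℕ} (hr : r ∈ box (d + 1) N) : Spr (piK (toSite r) N) :=
  ⟨cP d N 1, 1, one_pos, decays_piK hN hr zero_le_one⟩

/-- [folklore] So is its transpose. -/
theorem spr_trK_piK {N : ℕ} (hN : 1 ≤ N) {r : Fin (d + 1) → ℕ} (hr : r ∈ box (d + 1) N) :
    Spr (trK (piK (toSite r) N)) :=
  (spr_piK hN hr).trK

/-- [folklore] **BLOCK-TRANSLATION INVARIANCE** of the projector kernel: `shiftK (−N•t) (piK ρ N) = piK ρ N` (`pm_shift`). -/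
theorem shiftK_piK (ρ : Fin (d + 1) → ℤ) {N : ℕ} (hN : 1 ≤ N) (t : Fin (d + 1) → ℤ) :
    shiftK (-((N : ℤ) • t)) (piK ρ N) = piK ρ N := by
  funext x x' a b
  show piK ρ N (x + -((N : ℤ) • t)) (x' + -((N : ℤ) • t)) a b = piK ρ N x x' a b
  rcases a with α | m <;> rcases b with β | m'
  · rw [piK_inl_inl, piK_inl_inl, add_sub_add_right_eq_sub,
      show -((N : ℤ) • t) = (N : ℤ) • (-t) from (smul_neg _ _).symm, pm_shift ρ hN]
  · rfl
  · rfl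
  · rw [piK_inr_inr, piK_inr_inr]
    simp only [add_left_inj]

end PiKBounds

/-! ## §2 The rooted dressings are kernel compositions with `piK` -/

section Comp

variable (ρ : Fin (d + 1) → ℤ) (N : ℕ)

/-- [folklore] **`Πᵀ_ρ` ON THE FIRST LEG IS LEFT COMPOSITION WITH `piK`**: `legCo₁At ρ N K = comp (piK ρ N) K`. -/
theorem legCo₁At_eq_comp (K : MKer (d + 1) (Fib d)) : legCo₁At ρ N K = comp (piK ρ N) K := by
  funext x y a b
  rcases a with α | m
  · rw [legCo₁At_inl, coProjAt_apply]
    unfold ExpKernelCalculus.comp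
    simp_rw [sum_piK_mul_inl]
    rw [tsum_window]
  · rw [legCo₁At_inr]
    unfold ExpKernelCalculus.comp
    simp_rw [sum_piK_mul_inr]
    rw [tsum_point]

/-- [folklore] **`Πᵀ_ρ` ON THE SECOND LEG IS RIGHT COMPOSITION WITH `trK piK`**: `legCo₂At ρ N K = comp K (trK (piK ρ N))`. -/
theorem legCo₂At_eq_comp (K : MKer (d + 1) (Fib d)) : legCo₂At ρ N K = comp K (trK (piK ρ N)) := by
  funext x y a b
  rcases b with β | m
  · rw [legCo₂At_inl, coProjAt_apply]
    unfold ExpKernelCalculus.comp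
    simp only [trK]
    simp_rw [sum_mul_piK_inl]
    rw [tsum_window]
  · rw [legCo₂At_inr]
    unfold ExpKernelCalculus.comp
    simp only [trK]
    simp_rw [sum_mul_piK_inr]
    rw [tsum_point]

/-- [folklore] **THE ROOTED DRESSING AS A CONGRUENCE**: `dressKAt ρ N K = piK ∘ K ∘ piKᵀ` (`Πᵀ_ρ K Π_ρ` in the letters of
X-an2-41). -/
theorem dressKAt_eq_comp (K : MKer (d + 1) (Fib d)) :
    dressKAt ρ N K = comp (comp (piK ρ N) K) (trK (piK ρ N)) := by
  rw [dressKAt_eq, legCo₁At_eq_comp, legCo₂At_eq_comp]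

/-- [folklore] Right composition with `piK` does not touch a MULTIPLIER column. -/
theorem comp_piK_inr (A : MKer (d + 1) (Fib d)) (x y : Fin (d + 1) → ℤ) (a : Fib d) (μ : Fin (d + 1)) :
    comp A (piK ρ N) x y a (Sum.inr μ) = A x y a (Sum.inr μ) := by
  unfold ExpKernelCalculus.comp
  have h : ∀ y', ∑ f : Fib d, A x y' a f * piK ρ N y' y f (Sum.inr μ) = if y' = y then A x y' a (Sum.inr μ) else 0 := by
    intro y'
    rw [Fintype.sum_sum_type]
    simp only [piK_inl_inr, piK_inr_inr, mul_zero, Finset.sum_const_zero, zero_add]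
    by_cases hy : y' = y
    · simp only [hy, true_and, mul_ite, mul_one, mul_zero, Finset.sum_ite_eq', Finset.mem_univ, if_true]
    · simp [hy]
  simp_rw [h]
  rw [tsum_point']

/-- [folklore] Left composition with `trK piK` does not touch a MULTIPLIER row. -/
theorem trK_piK_comp_inr (A : MKer (d + 1) (Fib d)) (x y : Fin (d + 1) → ℤ) (μ : Fin (d + 1)) (b : Fib d) :
    comp (trK (piK ρ N)) A x y (Sum.inr μ) b = A x y (Sum.inr μ) b := by
  unfold ExpKernelCalculus.comp
  simp only [trK]
  have h : ∀ x', ∑ f : Fib d, piK ρ N x' x f (Sum.inr μ) * A x' y f b = if x' = x then A x' y (Sum.inr μ) b else 0 := by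
    intro x'
    rw [Fintype.sum_sum_type]
    simp only [piK_inl_inr, piK_inr_inr, zero_mul, Finset.sum_const_zero, zero_add]
    by_cases hx : x' = x
    · simp only [hx, true_and, ite_mul, one_mul, zero_mul, Finset.sum_ite_eq', Finset.mem_univ, if_true]
    · simp [hx]
  simp_rw [h]
  rw [tsum_point']

end Comp

/-! ## §3 The co-dressed kernel `G = Π_ρ K Πᵀ_ρ` -/

section CoDress

variable (ρ : Fin (d + 1) → ℤ) (N : ℕ)

/-- [folklore] **THE CO-DRESSED KERNEL** `coDressKAt ρ N K := piKᵀ ∘ K ∘ piK` — in the letters of X-an2-41 `G = Π K Πᵀ`, the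
kernel that meets the UNDRESSED jets when the dressed jets are traced against `K` (§5). -/
def coDressKAt (K : MKer (d + 1) (Fib d)) : MKer (d + 1) (Fib d) :=
  comp (comp (trK (piK ρ N)) K) (piK ρ N)

/-- [folklore] `coDressKAt` unfolds. -/
theorem coDressKAt_eq (K : MKer (d + 1) (Fib d)) :
    coDressKAt ρ N K = comp (comp (trK (piK ρ N)) K) (piK ρ N) := rfl

/-- [folklore] **THE `ℋ`-COLUMN OF THE CO-DRESSED KERNEL** is the windowed `Π_ρ`-image of the `ℋ`-column of `K`:
`colH (coDressKAt ρ N K) N μ y κ′ u′ = Σ_{v ∈ cube} Σ_κ pm ρ N κ′ u′ κ (u′ − v) · colH K N μ y κ (u′ − v)`. -/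
theorem colH_coDressKAt (K : MKer (d + 1) (Fib d)) (μ : Fin (d + 1)) (y : Fin (d + 1) → ℤ) (κ' : Fin (d + 1))
    (u' : Fin (d + 1) → ℤ) :
    colH (coDressKAt ρ N K) N μ y κ' u' =
      ∑ v ∈ cube (d + 1) N, ∑ κ : Fin (d + 1), (pm ρ N κ' u' κ (u' - v) : ℝ) * colH K N μ y κ (u' - v) := by
  unfold colH
  rw [coDressKAt_eq, comp_piK_inr]
  unfold ExpKernelCalculus.comp
  simp only [trK]
  have h : ∀ u, ∑ f : Fib d, piK ρ N u u' f (Sum.inl κ') * K u ((N : ℤ) • y) f (Sum.inr μ) =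
      if u' - u ∈ cube (d + 1) N then
        ∑ κ : Fin (d + 1), (pm ρ N κ' u' κ u : ℝ) * K u ((N : ℤ) • y) (Sum.inl κ) (Sum.inr μ) else 0 := by
    intro u
    exact sum_piK_col_inl ρ N u u' κ' (fun f => K u ((N : ℤ) • y) f (Sum.inr μ))
  simp_rw [h]
  rw [tsum_window']

end CoDress

end

end Summit.QuantumFields.BalabanUV.Beta.AxialDressingRooted
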